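import Mathlib
import Summits.Ventures.PercRepro2.CoinChainXASixTopGate
import Summits.Ventures.PercRepro2.CoinChainXAGateAffine
import Summits.Ventures.PercRepro2.CoinChainMixedCentreChain

/-!
# The six-cell sub-case of (XA′) on the CONVEX HULL of the proved gates
(blind cell PercRepro2, night-2 g27; proofs/NIGHT2-DARC.md §68.12)

In the six-cell sub-case (`ent = {m}`, `ent' = {j, j'}`, entry markers `x = 1[m ∈ ·]`, `y = 1[j ∈ ·]`)
four gates are proved: the closed gate `0` (`chain_XA'_six_zero_gate`, certificate
`a0·U001 − Cross = A·(a0·o·r₁u + a0·[Fact 3] + 2|Q|·[Fact 1])`), the gate `d·1[m ∈ W]` and the open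
gate `d` (there `P⁰ = 0`, `Cross = 0`: `chain_XA'_of_gate_on_De` with `chain_world1_mixed_nonneg`),
and the top gate `d·1[{m, j} ⊆ W]` (`chain_XA'_six_topgate`).  Since (XA′) is affine in the gate
(`xa_gate_affine3`), it holds on their convex hull (`chain_XA'_six_gate_hull`): every gate
`d' = θ₁·d·1[{m,j} ⊆ W] + θ₂·d·1[m ∈ W] + θ₃·d` with `θᵢ ≥ 0`, `θ₁ + θ₂ + θ₃ ≤ 1`; and the chain at
every `ρ` for such gates (`chain_functional_nonneg_six_gate_hull`).
-/

namespace Summit.Ventures.PercRepro2.Coin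

open Classical


section SixCellHull

variable {V : Type*} [DecidableEq V] {R : Type*} [Field R] [LinearOrder R] [IsStrictOrderedRing R]

/-- FACT 1 of §68.11 on the cell sums: `a₁·(b_u + r₀u) ≤ (o + a₀)·r₁u` — (νc on D′₁) × (νd on D″ ∪ D*₀)
≤ (νc on I₀ ∪ D′₀) × (νd on D*₁). -/
lemma six_fact1 (U : Finset V) (m j j' : V) (ν c d : Finset V → R)
    (hν0 : ∀ W, 0 ≤ ν W) (hν : ∀ s ⊆ U, ∀ t ⊆ U, ν s * ν t ≤ ν (s ∩ t) * ν (s ∪ t))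
    (hc0 : ∀ W, 0 ≤ c W) (hd0 : ∀ W, 0 ≤ d W)
    (hcd : ∀ s t, c s * d t ≤ c (s ∩ t) * d (s ∪ t)) :
    (∑ W ∈ U.powerset.filter (fun W => m ∉ W ∧ j ∈ W), ν W * c W) * ((∑ W ∈ U.powerset.filter (fun W => m ∈ W ∧ j ∉ W ∧ j' ∉ W), ν W * d W) + (∑ W ∈ U.powerset.filter (fun W => m ∈ W ∧ j ∉ W ∧ j' ∈ W), ν W * d W)) ≤
      ((∑ W ∈ U.powerset.filter (fun W => m ∉ W ∧ j ∉ W ∧ j' ∉ W), ν W * c W) + (∑ W ∈ U.powerset.filter (fun W => m ∉ W ∧ j ∉ W ∧ j' ∈ W), ν W * c W)) * (∑ W ∈ U.powerset.filter (fun W => m ∈ W ∧ j ∈ W), ν W * d W) := by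
  have hcd' : ∀ s ⊆ U, ∀ t ⊆ U, ν s * c s * (ν t * d t) ≤ ν (s ∩ t) * c (s ∩ t) * (ν (s ∪ t) * d (s ∪ t)) := by
    intro s hs t ht
    calc ν s * c s * (ν t * d t) = (ν s * ν t) * (c s * d t) := by ring
      _ ≤ (ν (s ∩ t) * ν (s ∪ t)) * (c (s ∩ t) * d (s ∪ t)) :=
          mul_le_mul (hν s hs t ht) (hcd s t) (mul_nonneg (hc0 _) (hd0 _)) (mul_nonneg (hν0 _) (hν0 _))
      _ = _ := by ring
  have f1 := ad_sets_dec U (fun W => ν W * c W) (fun W => ν W * d W) (fun W => ν W * c W) (fun W => ν W * d W)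
    (fun W => mul_nonneg (hν0 W) (hc0 W)) (fun W => mul_nonneg (hν0 W) (hd0 W))
    (fun W => mul_nonneg (hν0 W) (hc0 W)) (fun W => mul_nonneg (hν0 W) (hd0 W))
    (fun W => m ∉ W ∧ j ∈ W) (fun W => m ∈ W ∧ j ∉ W) (fun W => m ∉ W ∧ j ∉ W) (fun W => m ∈ W ∧ j ∈ W)
    (fun s hs t ht hA hB => ⟨⟨fun h => hA.1 (Finset.mem_inter.1 h).1, fun h => hB.2 (Finset.mem_inter.1 h).2⟩,
      ⟨Finset.mem_union_right _ hB.1, Finset.mem_union_left _ hA.2⟩, hcd' s hs t ht⟩)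
  rwa [sum_split_x U m j j', sum_split_low U m j j'] at f1

/-- FACT 3 of §68.11: `a₁·a₀u ≤ (o + a₀)·a₁u` — (νc on D′₁) × (νd on D′₀) ≤ (νc on I₀ ∪ D′₀) × (νd on D′₁). -/
lemma six_fact3 (U : Finset V) (m j j' : V) (ν c d : Finset V → R)
    (hν0 : ∀ W, 0 ≤ ν W) (hν : ∀ s ⊆ U, ∀ t ⊆ U, ν s * ν t ≤ ν (s ∩ t) * ν (s ∪ t))
    (hc0 : ∀ W, 0 ≤ c W) (hd0 : ∀ W, 0 ≤ d W)
    (hcd : ∀ s t, c s * d t ≤ c (s ∩ t) * d (s ∪ t)) :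
    (∑ W ∈ U.powerset.filter (fun W => m ∉ W ∧ j ∈ W), ν W * c W) * (∑ W ∈ U.powerset.filter (fun W => m ∉ W ∧ j ∉ W ∧ j' ∈ W), ν W * d W) ≤
      ((∑ W ∈ U.powerset.filter (fun W => m ∉ W ∧ j ∉ W ∧ j' ∉ W), ν W * c W) + (∑ W ∈ U.powerset.filter (fun W => m ∉ W ∧ j ∉ W ∧ j' ∈ W), ν W * c W)) * (∑ W ∈ U.powerset.filter (fun W => m ∉ W ∧ j ∈ W), ν W * d W) := by
  have hcd' : ∀ s ⊆ U, ∀ t ⊆ U, ν s * c s * (ν t * d t) ≤ ν (s ∩ t) * c (s ∩ t) * (ν (s ∪ t) * d (s ∪ t)) := by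
    intro s hs t ht
    calc ν s * c s * (ν t * d t) = (ν s * ν t) * (c s * d t) := by ring
      _ ≤ (ν (s ∩ t) * ν (s ∪ t)) * (c (s ∩ t) * d (s ∪ t)) :=
          mul_le_mul (hν s hs t ht) (hcd s t) (mul_nonneg (hc0 _) (hd0 _)) (mul_nonneg (hν0 _) (hν0 _))
      _ = _ := by ring
  have f3 := ad_sets_dec U (fun W => ν W * c W) (fun W => ν W * d W) (fun W => ν W * c W) (fun W => ν W * d W)
    (fun W => mul_nonneg (hν0 W) (hc0 W)) (fun W => mul_nonneg (hν0 W) (hd0 W))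
    (fun W => mul_nonneg (hν0 W) (hc0 W)) (fun W => mul_nonneg (hν0 W) (hd0 W))
    (fun W => m ∉ W ∧ j ∈ W) (fun W => m ∉ W ∧ j ∉ W ∧ j' ∈ W) (fun W => m ∉ W ∧ j ∉ W) (fun W => m ∉ W ∧ j ∈ W)
    (fun s hs t ht hA hB => ⟨⟨fun h => hA.1 (Finset.mem_inter.1 h).1, fun h => hB.2.1 (Finset.mem_inter.1 h).2⟩,
      ⟨fun h => (Finset.mem_union.1 h).elim hA.1 hB.1, Finset.mem_union_left _ hA.2⟩, hcd' s hs t ht⟩)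
  rwa [sum_split_low U m j j'] at f3

/-- The closed-gate certificate in the eight cell masses (`d' ≡ 0`: `e0 = o + a₀ + a₁`, `e1 = 0`,
`e2 = a₁`, `g0 = o`, `g1 = g2 = g12 = 0`): `a0·U001 − Cross = A·(a0·o·r₁u + a0·[Fact 3] + 2|Q|·[Fact 1])`. -/
theorem xa_six_zero_cert (o a₀ a₁ a₀u a₁u bu r₀u r₁u : R)
    (ho : 0 ≤ o) (ha₀ : 0 ≤ a₀) (ha₁ : 0 ≤ a₁)
    (hbu : 0 ≤ bu) (hr₀u : 0 ≤ r₀u) (hr₁u : 0 ≤ r₁u) (hQ0 : a₀u ≤ a₀) (hQ1 : a₁u ≤ a₁)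
    (h1 : a₁ * (bu + r₀u) ≤ (o + a₀) * r₁u) (h3 : a₁ * a₀u ≤ (o + a₀) * a₁u) :
    ((o + a₀ + a₁ + bu + r₀u + r₁u) * (bu + r₀u + r₁u)
        - (bu + r₀u + r₁u) * (o + a₀u + a₁u + bu + r₀u + r₁u)) *
      ((o + a₀ + a₁ + bu + r₀u + r₁u) * a₁ - (a₁ + r₁u) * (o + a₀ + a₁))
    + ((o + a₀ + a₁ + bu + r₀u + r₁u) * (a₁u + r₁u)
        - (a₁ + r₁u) * (o + a₀u + a₁u + bu + r₀u + r₁u)) *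
      ((o + a₀ + a₁ + bu + r₀u + r₁u) * 0 - (bu + r₀u + r₁u) * (o + a₀ + a₁))
    ≤ (o + a₀ + a₁ + bu + r₀u + r₁u) *
        ((o + a₀ + a₁ + bu + r₀u + r₁u) * (o + a₀ + a₁ + bu + r₀u + r₁u) * 0
          - (o + a₀ + a₁ + bu + r₀u + r₁u) * (a₁ + r₁u) * 0
          - (o + a₀ + a₁ + bu + r₀u + r₁u) * (bu + r₀u + r₁u) * 0
          + (bu + r₀u + r₁u) * (a₁ + r₁u) * o) := by
  have hQf1 : 0 ≤ ((a₀ - a₀u) + (a₁ - a₁u)) * ((o + a₀) * r₁u - a₁ * (bu + r₀u)) :=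
    mul_nonneg (add_nonneg (sub_nonneg.2 hQ0) (sub_nonneg.2 hQ1)) (sub_nonneg.2 h1)
  have hpos : 0 ≤ (bu + r₀u + r₁u) * (o + a₀ + a₁ + bu + r₀u + r₁u) * o * r₁u := by positivity
  linear_combination ((bu + r₀u + r₁u) * (o + a₀ + a₁ + bu + r₀u + r₁u)) * h3
    + (2 * (bu + r₀u + r₁u)) * hQf1 + hpos

/-- **(XA′) FOR THE SIX-CELL SUB-CASE WITH THE CLOSED GATE** `d' ≡ 0`. -/
theorem chain_XA'_six_zero_gate (U : Finset V) (m j j' : V) (ν c d : Finset V → R)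
    (hν0 : ∀ W, 0 ≤ ν W) (hν : ∀ s ⊆ U, ∀ t ⊆ U, ν s * ν t ≤ ν (s ∩ t) * ν (s ∪ t))
    (hc0 : ∀ W, 0 ≤ c W) (hd0 : ∀ W, 0 ≤ d W) (hdc : ∀ W, d W ≤ c W)
    (hcd : ∀ s t, c s * d t ≤ c (s ∩ t) * d (s ∪ t))
    (x y : Finset V → R) (hx : ∀ W, x W = if m ∈ W then 1 else 0)
    (hy : ∀ W, y W = if j ∈ W then 1 else 0) :
    (((∑ W ∈ U.powerset, ν W * chainMix {m} {j, j'} 0 c d W) * (∑ W ∈ U.powerset, ν W * chainMix {m} {j, j'} 1 c d W * x W) - (∑ W ∈ U.powerset, ν W * chainMix {m} {j, j'} 0 c d W * x W) * (∑ W ∈ U.powerset, ν W * chainMix {m} {j, j'} 1 c d W)) *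
          ((∑ W ∈ U.powerset, ν W * chainMix {m} {j, j'} 0 c d W) * (∑ W ∈ U.powerset, ν W * chainMix {m} {j, j'} 0 c (fun _ => 0) W * y W) - (∑ W ∈ U.powerset, ν W * chainMix {m} {j, j'} 0 c d W * y W) * (∑ W ∈ U.powerset, ν W * chainMix {m} {j, j'} 0 c (fun _ => 0) W))
        + ((∑ W ∈ U.powerset, ν W * chainMix {m} {j, j'} 0 c d W) * (∑ W ∈ U.powerset, ν W * chainMix {m} {j, j'} 1 c d W * y W) - (∑ W ∈ U.powerset, ν W * chainMix {m} {j, j'} 0 c d W * y W) * (∑ W ∈ U.powerset, ν W * chainMix {m} {j, j'} 1 c d W)) *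
          ((∑ W ∈ U.powerset, ν W * chainMix {m} {j, j'} 0 c d W) * (∑ W ∈ U.powerset, ν W * chainMix {m} {j, j'} 0 c (fun _ => 0) W * x W) - (∑ W ∈ U.powerset, ν W * chainMix {m} {j, j'} 0 c d W * x W) * (∑ W ∈ U.powerset, ν W * chainMix {m} {j, j'} 0 c (fun _ => 0) W))) ≤
        (∑ W ∈ U.powerset, ν W * chainMix {m} {j, j'} 0 c d W) * ((∑ W ∈ U.powerset, ν W * chainMix {m} {j, j'} 0 c d W) * (∑ W ∈ U.powerset, ν W * chainMix {m} {j, j'} 0 c d W) * (∑ W ∈ U.powerset, ν W * chainMix {m} {j, j'} 1 c (fun _ => 0) W * (x W * y W))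
          - (∑ W ∈ U.powerset, ν W * chainMix {m} {j, j'} 0 c d W) * (∑ W ∈ U.powerset, ν W * chainMix {m} {j, j'} 0 c d W * y W) * (∑ W ∈ U.powerset, ν W * chainMix {m} {j, j'} 1 c (fun _ => 0) W * x W)
          - (∑ W ∈ U.powerset, ν W * chainMix {m} {j, j'} 0 c d W) * (∑ W ∈ U.powerset, ν W * chainMix {m} {j, j'} 0 c d W * x W) * (∑ W ∈ U.powerset, ν W * chainMix {m} {j, j'} 1 c (fun _ => 0) W * y W)
          + (∑ W ∈ U.powerset, ν W * chainMix {m} {j, j'} 0 c d W * x W) * (∑ W ∈ U.powerset, ν W * chainMix {m} {j, j'} 0 c d W * y W) * (∑ W ∈ U.powerset, ν W * chainMix {m} {j, j'} 1 c (fun _ => 0) W)) := by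
  rw [six_a0 U m j j' ν c d, six_a1 U m j j' ν c d x hx, six_a2 U m j j' ν c d y hy,
    six_b0 U m j j' ν c d, six_b1 U m j j' ν c d x hx, six_b2 U m j j' ν c d y hy,
    six_e0 U m j j' ν c (fun _ => 0), six_e1 U m j j' ν c (fun _ => 0) x hx,
    six_e2 U m j j' ν c (fun _ => 0) y hy, six_g0 U m j j' ν c (fun _ => 0),
    six_g1 U m j j' ν c (fun _ => 0) x hx, six_g2 U m j j' ν c (fun _ => 0) y hy,
    six_g12 U m j j' ν c (fun _ => 0) x hx y hy]
  simp only [mul_zero, Finset.sum_const_zero, add_zero]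
  have f1 := six_fact1 U m j j' ν c d hν0 hν hc0 hd0 hcd
  have f3 := six_fact3 U m j j' ν c d hν0 hν hc0 hd0 hcd
  have hQ0 : (∑ W ∈ U.powerset.filter (fun W => m ∉ W ∧ j ∉ W ∧ j' ∈ W), ν W * d W) ≤
      ∑ W ∈ U.powerset.filter (fun W => m ∉ W ∧ j ∉ W ∧ j' ∈ W), ν W * c W :=
    Finset.sum_le_sum (fun W _ => mul_le_mul_of_nonneg_left (hdc W) (hν0 W))
  have hQ1 : (∑ W ∈ U.powerset.filter (fun W => m ∉ W ∧ j ∈ W), ν W * d W) ≤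
      ∑ W ∈ U.powerset.filter (fun W => m ∉ W ∧ j ∈ W), ν W * c W :=
    Finset.sum_le_sum (fun W _ => mul_le_mul_of_nonneg_left (hdc W) (hν0 W))
  linear_combination xa_six_zero_cert _ _ _ _ _ _ _ _
    (cell_nonneg U ν c hν0 hc0 (fun W => m ∉ W ∧ j ∉ W ∧ j' ∉ W))
    (cell_nonneg U ν c hν0 hc0 (fun W => m ∉ W ∧ j ∉ W ∧ j' ∈ W))
    (cell_nonneg U ν c hν0 hc0 (fun W => m ∉ W ∧ j ∈ W))
    (cell_nonneg U ν d hν0 hd0 (fun W => m ∈ W ∧ j ∉ W ∧ j' ∉ W))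
    (cell_nonneg U ν d hν0 hd0 (fun W => m ∈ W ∧ j ∉ W ∧ j' ∈ W))
    (cell_nonneg U ν d hν0 hd0 (fun W => m ∈ W ∧ j ∈ W)) hQ0 hQ1 f1 f3

omit [LinearOrder R] [IsStrictOrderedRing R] in
/-- If the gate agrees with `d` on the clusters meeting `ent`, the coin-closed gate law is the
coin-closed law. -/
lemma chainMix_zero_of_on_De (ent ent' : Finset V) (c d d' : Finset V → R)
    (hd' : ∀ W, (∃ r ∈ ent, r ∈ W) → d' W = d W) (W : Finset V) :
    chainMix ent ent' 0 c d' W = chainMix ent ent' 0 c d W := by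
  unfold chainMix chainTheta
  by_cases h : ∃ r ∈ ent, r ∈ W
  · simp [h, hd' W h]
  · simp [h]

omit [LinearOrder R] [IsStrictOrderedRing R] in
/-- The `G⁰`-moments of such a gate are the `R⁰`-moments. -/
lemma sum_gate_on_De (U ent ent' : Finset V) (ν c d d' : Finset V → R)
    (hd' : ∀ W, (∃ r ∈ ent, r ∈ W) → d' W = d W) (f : Finset V → R) :
    ∑ W ∈ U.powerset, ν W * chainMix ent ent' 0 c d' W * f W =
      ∑ W ∈ U.powerset, ν W * chainMix ent ent' 0 c d W * f W :=
  Finset.sum_congr rfl (fun W _ => by rw [chainMix_zero_of_on_De ent ent' c d d' hd'])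

omit [LinearOrder R] [IsStrictOrderedRing R] in
/-- The `G⁰`-mass of such a gate is the `R⁰`-mass. -/
lemma sum_gate_on_De' (U ent ent' : Finset V) (ν c d d' : Finset V → R)
    (hd' : ∀ W, (∃ r ∈ ent, r ∈ W) → d' W = d W) :
    ∑ W ∈ U.powerset, ν W * chainMix ent ent' 0 c d' W =
      ∑ W ∈ U.powerset, ν W * chainMix ent ent' 0 c d W :=
  Finset.sum_congr rfl (fun W _ => by rw [chainMix_zero_of_on_De ent ent' c d d' hd'])

/-- **(XA′) WHEN THE GATE DOES NOT ACT ON THE SURE-ENTERED CLUSTERS**: if `d' = d` on every cluster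
meeting `ent`, then `P⁰ = 0`, `Cross = 0`, and (XA′) is `U001 ≥ 0` (the world-1 gate functional at
the world-0 means, `chain_world1_mixed_nonneg` at `ρ₁ = ρ₂ = 0`, taken here as the hypothesis `hU`). -/
theorem chain_XA'_of_gate_on_De (U ent ent' : Finset V) (ν c d d' : Finset V → R)
    (hd' : ∀ W, (∃ r ∈ ent, r ∈ W) → d' W = d W)
    (ha0 : 0 ≤ ∑ W ∈ U.powerset, ν W * chainMix ent ent' 0 c d W) (x y : Finset V → R)
    (hU : 0 ≤ (∑ W ∈ U.powerset, ν W * chainMix ent ent' 0 c d W) *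
          (∑ W ∈ U.powerset, ν W * chainMix ent ent' 0 c d W) *
          (∑ W ∈ U.powerset, ν W * chainMix ent ent' 1 c d' W * (x W * y W))
        - (∑ W ∈ U.powerset, ν W * chainMix ent ent' 0 c d W) *
          (∑ W ∈ U.powerset, ν W * chainMix ent ent' 0 c d W * y W) *
          (∑ W ∈ U.powerset, ν W * chainMix ent ent' 1 c d' W * x W)
        - (∑ W ∈ U.powerset, ν W * chainMix ent ent' 0 c d W) *
          (∑ W ∈ U.powerset, ν W * chainMix ent ent' 0 c d W * x W) *
          (∑ W ∈ U.powerset, ν W * chainMix ent ent' 1 c d' W * y W)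
        + (∑ W ∈ U.powerset, ν W * chainMix ent ent' 0 c d W * x W) *
          (∑ W ∈ U.powerset, ν W * chainMix ent ent' 0 c d W * y W) *
          (∑ W ∈ U.powerset, ν W * chainMix ent ent' 1 c d' W)) :
    (((∑ W ∈ U.powerset, ν W * chainMix ent ent' 0 c d W) * (∑ W ∈ U.powerset, ν W * chainMix ent ent' 1 c d W * x W) - (∑ W ∈ U.powerset, ν W * chainMix ent ent' 0 c d W * x W) * (∑ W ∈ U.powerset, ν W * chainMix ent ent' 1 c d W)) *
          ((∑ W ∈ U.powerset, ν W * chainMix ent ent' 0 c d W) * (∑ W ∈ U.powerset, ν W * chainMix ent ent' 0 c d' W * y W) - (∑ W ∈ U.powerset, ν W * chainMix ent ent' 0 c d W * y W) * (∑ W ∈ U.powerset, ν W * chainMix ent ent' 0 c d' W))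
        + ((∑ W ∈ U.powerset, ν W * chainMix ent ent' 0 c d W) * (∑ W ∈ U.powerset, ν W * chainMix ent ent' 1 c d W * y W) - (∑ W ∈ U.powerset, ν W * chainMix ent ent' 0 c d W * y W) * (∑ W ∈ U.powerset, ν W * chainMix ent ent' 1 c d W)) *
          ((∑ W ∈ U.powerset, ν W * chainMix ent ent' 0 c d W) * (∑ W ∈ U.powerset, ν W * chainMix ent ent' 0 c d' W * x W) - (∑ W ∈ U.powerset, ν W * chainMix ent ent' 0 c d W * x W) * (∑ W ∈ U.powerset, ν W * chainMix ent ent' 0 c d' W))) ≤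
        (∑ W ∈ U.powerset, ν W * chainMix ent ent' 0 c d W) * ((∑ W ∈ U.powerset, ν W * chainMix ent ent' 0 c d W) * (∑ W ∈ U.powerset, ν W * chainMix ent ent' 0 c d W) * (∑ W ∈ U.powerset, ν W * chainMix ent ent' 1 c d' W * (x W * y W))
          - (∑ W ∈ U.powerset, ν W * chainMix ent ent' 0 c d W) * (∑ W ∈ U.powerset, ν W * chainMix ent ent' 0 c d W * y W) * (∑ W ∈ U.powerset, ν W * chainMix ent ent' 1 c d' W * x W)
          - (∑ W ∈ U.powerset, ν W * chainMix ent ent' 0 c d W) * (∑ W ∈ U.powerset, ν W * chainMix ent ent' 0 c d W * x W) * (∑ W ∈ U.powerset, ν W * chainMix ent ent' 1 c d' W * y W)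
          + (∑ W ∈ U.powerset, ν W * chainMix ent ent' 0 c d W * x W) * (∑ W ∈ U.powerset, ν W * chainMix ent ent' 0 c d W * y W) * (∑ W ∈ U.powerset, ν W * chainMix ent ent' 1 c d' W)) := by
  rw [sum_gate_on_De U ent ent' ν c d d' hd' x, sum_gate_on_De U ent ent' ν c d d' hd' y,
    sum_gate_on_De' U ent ent' ν c d d' hd']
  have key := mul_nonneg ha0 hU
  linear_combination key

omit [IsStrictOrderedRing R] in
/-- The gate `d·1[m ∈ W]` is nonnegative. -/
lemma gateM_nonneg (m : V) (d d' : Finset V → R) (hd0 : ∀ W, 0 ≤ d W)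
    (hd' : ∀ W, d' W = if m ∈ W then d W else 0) (W : Finset V) : 0 ≤ d' W := by
  rw [hd']; split_ifs <;> first | exact hd0 W | exact le_rfl

omit [IsStrictOrderedRing R] in
/-- The gate `d·1[m ∈ W]` is below `d`. -/
lemma gateM_le (m : V) (d d' : Finset V → R) (hd0 : ∀ W, 0 ≤ d W)
    (hd' : ∀ W, d' W = if m ∈ W then d W else 0) (W : Finset V) : d' W ≤ d W := by
  rw [hd']; split_ifs <;> first | exact le_rfl | exact hd0 W

/-- The gate `d·1[m ∈ W]` is log-supermodular when `d` is. -/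
lemma gateM_lsm (m : V) (d d' : Finset V → R) (hd0 : ∀ W, 0 ≤ d W)
    (hd' : ∀ W, d' W = if m ∈ W then d W else 0)
    (hdd : ∀ s t, d s * d t ≤ d (s ∩ t) * d (s ∪ t)) (s t : Finset V) :
    d' s * d' t ≤ d' (s ∩ t) * d' (s ∪ t) := by
  simp only [hd']
  by_cases hs : m ∈ s
  · by_cases ht : m ∈ t
    · rw [if_pos hs, if_pos ht, if_pos (Finset.mem_inter.2 ⟨hs, ht⟩), if_pos (Finset.mem_union_left _ hs)]
      exact hdd s t
    · rw [if_neg ht, mul_zero]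
      exact mul_nonneg (by split_ifs <;> first | exact hd0 _ | exact le_rfl)
        (by split_ifs <;> first | exact hd0 _ | exact le_rfl)
  · rw [if_neg hs, zero_mul]
    exact mul_nonneg (by split_ifs <;> first | exact hd0 _ | exact le_rfl)
      (by split_ifs <;> first | exact hd0 _ | exact le_rfl)

/-- Cross log-supermodularity of `f` against the gate `d·1[m ∈ W]`. -/
lemma gateM_cross (m : V) (f d d' : Finset V → R) (hf0 : ∀ W, 0 ≤ f W) (hd0 : ∀ W, 0 ≤ d W)
    (hd' : ∀ W, d' W = if m ∈ W then d W else 0)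
    (hfd : ∀ s t, f s * d t ≤ f (s ∩ t) * d (s ∪ t)) (s t : Finset V) :
    f s * d' t ≤ f (s ∩ t) * d' (s ∪ t) := by
  simp only [hd']
  by_cases ht : m ∈ t
  · rw [if_pos ht, if_pos (Finset.mem_union_right _ ht)]; exact hfd s t
  · rw [if_neg ht, mul_zero]
    exact mul_nonneg (hf0 _) (by split_ifs <;> first | exact hd0 _ | exact le_rfl)

/-- The ratio `d' / c` is increasing for the gate `d·1[m ∈ W]` when `d / c` is. -/
lemma gateM_ratio (m : V) (c d d' : Finset V → R) (hc0 : ∀ W, 0 ≤ c W) (hd0 : ∀ W, 0 ≤ d W)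
    (hd' : ∀ W, d' W = if m ∈ W then d W else 0)
    (hratio : ∀ s t, s ⊆ t → d s * c t ≤ c s * d t) (s t : Finset V) (hst : s ⊆ t) :
    d' s * c t ≤ c s * d' t := by
  simp only [hd']
  by_cases hs : m ∈ s
  · rw [if_pos hs, if_pos (hst hs)]; exact hratio s t hst
  · rw [if_neg hs, zero_mul]
    exact mul_nonneg (hc0 _) (by split_ifs <;> first | exact hd0 _ | exact le_rfl)

/-- A `{0, 1}`-marker is nonnegative. -/
lemma marker_nonneg (m : V) (x : Finset V → R) (hx : ∀ W, x W = if m ∈ W then 1 else 0) (W : Finset V) :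
    0 ≤ x W := by
  rw [hx]; split_ifs <;> norm_num

/-- A `{0, 1}`-marker is increasing. -/
lemma marker_mono (m : V) (x : Finset V → R) (hx : ∀ W, x W = if m ∈ W then 1 else 0) (s t : Finset V) :
    x s ≤ x (s ∪ t) := by
  rw [hx, hx]
  by_cases hs : m ∈ s
  · rw [if_pos hs, if_pos (Finset.mem_union_left _ hs)]
  · rw [if_neg hs]; split_ifs <;> norm_num

/-- **(XA′) ON THE CONVEX HULL OF THE PROVED GATES** (six-cell sub-case `ent = {m}`, `ent' = {j, j'}`,
`x = 1[m ∈ ·]`, `y = 1[j ∈ ·]`): for every gate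
`d' = θ₁·d·1[{m, j} ⊆ W] + θ₂·d·1[m ∈ W] + θ₃·d` with `θᵢ ≥ 0`, `θ₁ + θ₂ + θ₃ ≤ 1`
(the top gate, the gate open on the sure-entered clusters, the open gate and the closed gate), the
cleared (XA′) `Cross ≤ a0·U001` holds. -/
theorem chain_XA'_six_gate_hull (U : Finset V) (m j j' : V) (ν c d d' : Finset V → R)
    (hν0 : ∀ W, 0 ≤ ν W) (hν : ∀ s ⊆ U, ∀ t ⊆ U, ν s * ν t ≤ ν (s ∩ t) * ν (s ∪ t))
    (hc0 : ∀ W, 0 ≤ c W) (hd0 : ∀ W, 0 ≤ d W) (hdc : ∀ W, d W ≤ c W)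
    (hcc : ∀ s t, c s * c t ≤ c (s ∩ t) * c (s ∪ t))
    (hdd : ∀ s t, d s * d t ≤ d (s ∩ t) * d (s ∪ t))
    (hcd : ∀ s t, c s * d t ≤ c (s ∩ t) * d (s ∪ t))
    (hratio : ∀ s t, s ⊆ t → d s * c t ≤ c s * d t)
    (θ₁ θ₂ θ₃ : R) (hθ₁ : 0 ≤ θ₁) (hθ₂ : 0 ≤ θ₂) (hθ₃ : 0 ≤ θ₃) (hθ : θ₁ + θ₂ + θ₃ ≤ 1)
    (hd' : ∀ W, d' W = θ₁ * (if m ∈ W ∧ j ∈ W then d W else 0) + θ₂ * (if m ∈ W then d W else 0) + θ₃ * d W)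
    (x y : Finset V → R) (hx : ∀ W, x W = if m ∈ W then 1 else 0)
    (hy : ∀ W, y W = if j ∈ W then 1 else 0) :
    (((∑ W ∈ U.powerset, ν W * chainMix {m} {j, j'} 0 c d W) * (∑ W ∈ U.powerset, ν W * chainMix {m} {j, j'} 1 c d W * x W) - (∑ W ∈ U.powerset, ν W * chainMix {m} {j, j'} 0 c d W * x W) * (∑ W ∈ U.powerset, ν W * chainMix {m} {j, j'} 1 c d W)) *
          ((∑ W ∈ U.powerset, ν W * chainMix {m} {j, j'} 0 c d W) * (∑ W ∈ U.powerset, ν W * chainMix {m} {j, j'} 0 c d' W * y W) - (∑ W ∈ U.powerset, ν W * chainMix {m} {j, j'} 0 c d W * y W) * (∑ W ∈ U.powerset, ν W * chainMix {m} {j, j'} 0 c d' W))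
        + ((∑ W ∈ U.powerset, ν W * chainMix {m} {j, j'} 0 c d W) * (∑ W ∈ U.powerset, ν W * chainMix {m} {j, j'} 1 c d W * y W) - (∑ W ∈ U.powerset, ν W * chainMix {m} {j, j'} 0 c d W * y W) * (∑ W ∈ U.powerset, ν W * chainMix {m} {j, j'} 1 c d W)) *
          ((∑ W ∈ U.powerset, ν W * chainMix {m} {j, j'} 0 c d W) * (∑ W ∈ U.powerset, ν W * chainMix {m} {j, j'} 0 c d' W * x W) - (∑ W ∈ U.powerset, ν W * chainMix {m} {j, j'} 0 c d W * x W) * (∑ W ∈ U.powerset, ν W * chainMix {m} {j, j'} 0 c d' W))) ≤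
        (∑ W ∈ U.powerset, ν W * chainMix {m} {j, j'} 0 c d W) * ((∑ W ∈ U.powerset, ν W * chainMix {m} {j, j'} 0 c d W) * (∑ W ∈ U.powerset, ν W * chainMix {m} {j, j'} 0 c d W) * (∑ W ∈ U.powerset, ν W * chainMix {m} {j, j'} 1 c d' W * (x W * y W))
          - (∑ W ∈ U.powerset, ν W * chainMix {m} {j, j'} 0 c d W) * (∑ W ∈ U.powerset, ν W * chainMix {m} {j, j'} 0 c d W * y W) * (∑ W ∈ U.powerset, ν W * chainMix {m} {j, j'} 1 c d' W * x W)
          - (∑ W ∈ U.powerset, ν W * chainMix {m} {j, j'} 0 c d W) * (∑ W ∈ U.powerset, ν W * chainMix {m} {j, j'} 0 c d W * x W) * (∑ W ∈ U.powerset, ν W * chainMix {m} {j, j'} 1 c d' W * y W)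
          + (∑ W ∈ U.powerset, ν W * chainMix {m} {j, j'} 0 c d W * x W) * (∑ W ∈ U.powerset, ν W * chainMix {m} {j, j'} 0 c d W * y W) * (∑ W ∈ U.powerset, ν W * chainMix {m} {j, j'} 1 c d' W)) := by
  have hx0 := marker_nonneg m x hx
  have hy0 := marker_nonneg j y hy
  have hxm := marker_mono m x hx
  have hym := marker_mono j y hy
  have ha0 : 0 ≤ ∑ W ∈ U.powerset, ν W * chainMix {m} {j, j'} 0 c d W :=
    Finset.sum_nonneg (fun W _ => mul_nonneg (hν0 W) (chainMix_nonneg _ _ le_rfl zero_le_one hc0 hd0 W))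
  refine chain_XA'_of_gate_mix3 U {m} {j, j'} ν c d (fun W => if m ∈ W ∧ j ∈ W then d W else 0) (fun W => if m ∈ W then d W else 0) d d' θ₁ θ₂ θ₃ hθ₁ hθ₂ hθ₃ hθ
    (fun W => hd' W) x y ?_ ?_ ?_ ?_
  · exact chain_XA'_six_topgate U m j j' ν c d (fun W => if m ∈ W ∧ j ∈ W then d W else 0) hν0 hν hc0 hd0 hdc hcd (fun W => rfl) x y hx hy
  · refine chain_XA'_of_gate_on_De U {m} {j, j'} ν c d (fun W => if m ∈ W then d W else 0) ?_ ha0 x y ?_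
    · intro W h
      obtain ⟨r, hr, hrW⟩ := h
      rw [Finset.mem_singleton] at hr
      subst hr
      simp [hrW]
    · exact chain_world1_mixed_nonneg U {m} {j, j'} ν c d (fun W => if m ∈ W then d W else 0) 0 0 le_rfl zero_le_one le_rfl zero_le_one
        hν0 hν hc0 hd0 (gateM_nonneg m d _ hd0 (fun W => rfl)) hdc
        (fun W => le_trans (gateM_le m d _ hd0 (fun W => rfl) W) (hdc W)) hcc hdd
        (gateM_lsm m d _ hd0 (fun W => rfl) hdd) hcd (gateM_cross m c d _ hc0 hd0 (fun W => rfl) hcd)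
        (gateM_cross m d d _ hd0 hd0 (fun W => rfl) hdd) hratio (gateM_ratio m c d _ hc0 hd0 (fun W => rfl) hratio)
        x y hx0 hy0 hxm hym
  · refine chain_XA'_of_gate_on_De U {m} {j, j'} ν c d d (fun W _ => rfl) ha0 x y ?_
    exact chain_world1_mixed_nonneg U {m} {j, j'} ν c d d 0 0 le_rfl zero_le_one le_rfl zero_le_one
      hν0 hν hc0 hd0 hd0 hdc hdc hcc hdd hdd hcd hcd hdd hratio hratio x y hx0 hy0 hxm hym
  · exact chain_XA'_six_zero_gate U m j j' ν c d hν0 hν hc0 hd0 hdc hcd x y hx hy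

/-- **THE CHAIN AT EVERY `ρ` ON THE GATE HULL** (six-cell sub-case): for a gate
`d' = θ₁·d·1[{m, j} ⊆ W] + θ₂·d·1[m ∈ W] + θ₃·d` (`θᵢ ≥ 0`, `θ₁ + θ₂ + θ₃ ≤ 1`) satisfying the
standing gate hypotheses, the general AND-switch chain is nonnegative at every `ρ ∈ [0, 1]`. -/
theorem chain_functional_nonneg_six_gate_hull (U : Finset V) (m j j' : V) (ν c d d' : Finset V → R)
    (ρ : R) (hρ0 : 0 ≤ ρ) (hρ1 : ρ ≤ 1) (hν0 : ∀ W, 0 ≤ ν W)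
    (hν : ∀ s ⊆ U, ∀ t ⊆ U, ν s * ν t ≤ ν (s ∩ t) * ν (s ∪ t))
    (hc0 : ∀ W, 0 ≤ c W) (hd0 : ∀ W, 0 ≤ d W) (hd'0 : ∀ W, 0 ≤ d' W)
    (hdc : ∀ W, d W ≤ c W) (hd'c : ∀ W, d' W ≤ c W) (hd'd : ∀ W, d' W ≤ d W)
    (hcc : ∀ s t, c s * c t ≤ c (s ∩ t) * c (s ∪ t))
    (hdd : ∀ s t, d s * d t ≤ d (s ∩ t) * d (s ∪ t))
    (hd'd' : ∀ s t, d' s * d' t ≤ d' (s ∩ t) * d' (s ∪ t))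
    (hcd : ∀ s t, c s * d t ≤ c (s ∩ t) * d (s ∪ t))
    (hcd' : ∀ s t, c s * d' t ≤ c (s ∩ t) * d' (s ∪ t))
    (hdd' : ∀ s t, d s * d' t ≤ d (s ∩ t) * d' (s ∪ t))
    (hratio : ∀ s t, s ⊆ t → d s * c t ≤ c s * d t)
    (hratio' : ∀ s t, s ⊆ t → d' s * c t ≤ c s * d' t)
    (θ₁ θ₂ θ₃ : R) (hθ₁ : 0 ≤ θ₁) (hθ₂ : 0 ≤ θ₂) (hθ₃ : 0 ≤ θ₃) (hθ : θ₁ + θ₂ + θ₃ ≤ 1)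
    (hd' : ∀ W, d' W = θ₁ * (if m ∈ W ∧ j ∈ W then d W else 0) + θ₂ * (if m ∈ W then d W else 0) + θ₃ * d W)
    (x y : Finset V → R) (hx : ∀ W, x W = if m ∈ W then 1 else 0)
    (hy : ∀ W, y W = if j ∈ W then 1 else 0)
    (hpos0 : 0 < ∑ W ∈ U.powerset, ν W * chainMix {m} {j, j'} 0 c d W)
    (hpos1 : 0 < ∑ W ∈ U.powerset, ν W * chainMix {m} {j, j'} 1 c d W)
    (hmI : 0 < ∑ W ∈ U.powerset.filter (fun W => ¬ ∃ r ∈ ({m} : Finset V) ∪ {j, j'}, r ∈ W), ν W * c W) :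
    0 ≤ (∑ W ∈ U.powerset, ν W * chainMix {m} {j, j'} ρ c d W) ^ 2 *
          (∑ W ∈ U.powerset, ν W * chainMix {m} {j, j'} ρ c d' W * (x W * y W))
        - (∑ W ∈ U.powerset, ν W * chainMix {m} {j, j'} ρ c d W) *
          (∑ W ∈ U.powerset, ν W * chainMix {m} {j, j'} ρ c d W * x W) *
          (∑ W ∈ U.powerset, ν W * chainMix {m} {j, j'} ρ c d' W * y W)
        - (∑ W ∈ U.powerset, ν W * chainMix {m} {j, j'} ρ c d W) *
          (∑ W ∈ U.powerset, ν W * chainMix {m} {j, j'} ρ c d W * y W) *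
          (∑ W ∈ U.powerset, ν W * chainMix {m} {j, j'} ρ c d' W * x W)
        + (∑ W ∈ U.powerset, ν W * chainMix {m} {j, j'} ρ c d W * x W) *
          (∑ W ∈ U.powerset, ν W * chainMix {m} {j, j'} ρ c d W * y W) *
          (∑ W ∈ U.powerset, ν W * chainMix {m} {j, j'} ρ c d' W) :=
  chain_functional_nonneg_of_XA' U {m} {j, j'} ν c d d' ρ hρ0 hρ1 hν0 hν hc0 hd0 hd'0 hdc hd'c hd'd
    hcc hdd hd'd' hcd hcd' hdd' hratio hratio' x y (marker_nonneg m x hx) (marker_nonneg j y hy)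
    (marker_mono m x hx) (marker_mono j y hy) hpos0 hpos1 hmI
    (chain_XA'_six_gate_hull U m j j' ν c d d' hν0 hν hc0 hd0 hdc hcc hdd hcd hratio θ₁ θ₂ θ₃ hθ₁ hθ₂ hθ₃ hθ
      hd' x y hx hy)

end SixCellHull

end Summit.Ventures.PercRepro2.Coin
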